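import Literature.Computability.AlgebraicComplexity.PP13StrictUnimodality
import Literature.Computability.AlgebraicComplexity.GaussianCoefficientTable
import Literature.NumberTheory.DiophantineGeometry.KroneckerPointSets
import HarnessLib

/-!
# Pak–Panova 2013: strict unimodality of the `q`-binomial coefficients — PROVED
# (discharge of `PakPanova2013_thm_1` and of `DIP20_cor_4_8`)

Topic `Literature/Computability/AlgebraicComplexity`; a PROOFS file (D-0014): theorems only, no facts.

I. Pak, G. Panova, *Strict unimodality of `q`-binomial coefficients*, C. R. Math. Acad. Sci. Paris 351
(2013) 415–418 = arXiv:1306.5085 (held: `paper:arxiv-1306.5085`, pages p0002–p0004). With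
`binom(m+ℓ, m)_q = Σ_{n=0}^{ℓm} p_n(ℓ,m) qⁿ` (the tree's `boxPartitionCount n ℓ m`, DIP20's `p_n(ℓ,m)`:
partitions of `n` with at most `ℓ` parts, each at most `m`):

* **Thm. 1** (p0002): "For all `ℓ, m ≥ 8`, we have the following strict inequalities:
  `(∘)  p_1(ℓ,m) < … < p_{⌊ℓm/2⌋}(ℓ,m) = p_{⌈ℓm/2⌉}(ℓ,m) > … > p_{ℓm-1}(ℓ,m)`."
  — typed as the named fact `PakPanova2013_thm_1` (`StrictGaussianChain ℓ m` for `ℓ, m ≥ 8`) in the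
  statement file `PP13StrictUnimodality.lean` (val-lit x2) and **DISCHARGED here**:
  `PakPanova2013_thm_1_holds : PakPanova2013_thm_1`, from the working form
  `PakPanova2013_thm_1_strict` (`p_{k-1} < p_k` for `2 ≤ k ≤ ℓm/2`; the rest of `(∘)` is Sylvester's
  palindromicity `boxPartitionCount_compl`, the statement file's `PakPanova2013_thm_1_of_lt_below`).
* **Lemma 2** (Additivity Lemma, p0002; proof p0004): "Suppose inequalities `(∘)` as in the theorem
  hold for pairs `(ℓ,m₁)` and `(ℓ,m₂)`. Suppose also that at least one of integers `{ℓ,m₁,m₂}` is even,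
  and at least one `≥ 3`. Then `(∘)` holds for `(ℓ, m₁+m₂)`." — `PakPanova2013_lemma_2` (with the
  implicit `ℓ, m₁, m₂ ≥ 2` of the printed proof explicit), from the product-level form
  `strictGauss_add`.
* **Lemma 3** (p0003): `g(mˡ, mˡ, τ_k) = p_k(ℓ,m) - p_{k-1}(ℓ,m)` — ALREADY IN THE TREE:
  `kroneckerCoeff_rectangle_rectangle_twoRow` (`TwoRowRectangleKronecker.lean`, val-lit t05 g3); read
  here as `kroneckerCoeff_rectangle_twoRow_pos_iff`.
* **Thm. 4** (semigroup property, Christandl–Harrow–Mitchison; p0003) — ALREADY IN THE TREE: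
  `kroneckerCoeff_pos_of_getD_add` (`KroneckerPointSets.lean`, row form); specialised here to
  rectangles and two-row shapes as `kroneckerCoeff_rectangle_twoRow_pos_add` (the displayed step of the
  proof of Lemma 2, p0004: `g((m₁+m₂)ˡ, (m₁+m₂)ˡ, τ_{r+s}) = g(m₁ˡ + m₂ˡ, m₁ˡ + m₂ˡ, ν + γ) > 0`).
* **Thm. 6** (p0004), the parts formalised: the "direct calculation" base `ℓ, m ∈ {8,…,15}`
  (`strictGauss_grid`, by the kernel through the certified table `GaussTable.coeffList` of
  `GaussianCoefficientTable.lean`); the positive statement for `5 ≤ ℓ ≤ m` outside the nine printed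
  exceptional pairs (`PakPanova2013_thm_6_strict`); the exceptional pairs have "the middle three
  coefficients … equal" (`PakPanova2013_thm_6_exceptions`; except `(6,6)`, see PRINT NOTE 2) and so
  violate `(∘)`
  (`PakPanova2013_thm_6_exceptions_not_strict`); `ℓ = 2`: `(∘)` holds for `(2,2)` and fails for
  `m ≥ 3` since `p_2(2,m) = p_3(2,m) = 2` (`PakPanova2013_thm_6_two`). NOT formalised: the failure of
  `(∘)` for `ℓ ∈ {3, 4}` and all `m` (equal middle coefficients via the symmetric chain decompositions of
  [Lin], [West] quoted in the printed proof) — infinite families outside the reach of the table.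

PRINT NOTE 2 (Thm. 6, proof, p0004: the listed exceptional values are "where the middle three
coefficients of the expansion of `binom(ℓ+m, m)_q` are equal"): true for eight of the nine pairs; for
`(6,6)` the coefficients of `binom(12,6)_q` around the middle are `…, 51, 55, 55, 58, 55, 55, 51, …` — the
middle three `55, 58, 55` are NOT equal, and `(∘)` fails at `p_16 = p_17` instead (the pair is rightly
listed as exceptional; only the stated reason differs). Kernel values: `PakPanova2013_thm_6_exceptions`.

PRINT NOTE 1 (Thm. 6, proof, p0004: "we apply the additivity lemma for each value of `ℓ = 5, 6, 7` and
`m = 10a+b` where `10 ≤ b ≤ 19` and induct over `a` with the values `m₁ = 10(a-1)+b` and `m₂ = 10`"):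
for `ℓ = 5` and `ℓ = 7` this step invokes the pairs `(5,10)` and `(7,10)`, which are among the listed
exceptions (no strict unimodality, so Lemma 2 does not apply); for `ℓ = 6` it passes through the
exceptional `m₁ = 11, 13`. Statement-level nothing changes (val-lit lit g4 B19: for `ℓ ∈ {5,6,7}`,
`5 ≤ m < 80` the failures of `(∘)` are exactly the nine listed pairs). The induction below takes the
base cases `5 ≤ m ≤ 22` by direct computation (`(5,22)` and `(6,21)` are unreachable by additivity from
non-exceptional summands — they must be base cases), then steps `m₂ = 8` (`(5,8)`, `(6,8)`, `(7,8)` are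
strictly unimodal; `8` is even) — `strictGauss_five/six/seven`.

**Consequence for DIP20** (the purpose of this file in the val-lit cell): hypothesis (H2) of
`DIP20_cor_4_8_of_strict_unimodality` (`GaussianCoefficientUnimodality.lean`, t05 g3) — strict
unimodality of `p_k(n+1, n-2)` below the middle for `n ≥ 7` except `(n,k) = (8,26), (9,34)` — holds
(`DIP20_strict_unimodality`: `n ≥ 10` is Thm. 1 with `(ℓ,m) = (n+1, n-2)`, `n = 7, 8, 9` are the boxes
`8×5`, `9×6`, `10×7` by the table, the two exceptions being exactly the equal middle pairs
`p_26(9,6) = p_27(9,6)`, `p_34(10,7) = p_35(10,7)` of the exceptional pairs `(6,9)`, `(7,10)`), whence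
**`DIP20_cor_4_8_holds : DIP20_cor_4_8`** (Dörfler–Ikenmeyer–Panova 2020, Cor. 4.8 as typed with its
errata E3/E4, now a theorem; the named fact is DISCHARGED).

HONEST FRAMING (cell val-lit, seat t05 g4): combinatorics of Gaussian coefficients and Kronecker
coefficients of the symmetric group; DIP20's toy model. Nothing here bears on permanent versus
determinant; VP ≠ VNP is NOT proved.

## References

* [PakPanova2013] I. Pak, G. Panova, C. R. Math. Acad. Sci. Paris 351 (2013) 415–418 =
  arXiv:1306.5085: Thm. 1, Lemma 2, Lemma 3, Thm. 4, Thm. 6 (held `paper:arxiv-1306.5085`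
  p0002–p0004).
* [PakPanova2014Unimodality] I. Pak, G. Panova, J. Algebraic Combin. 40 (2014) = arXiv:1304.5044,
  Lemma 1.3 (= Lemma 3 here; tree `kroneckerCoeff_rectangle_rectangle_twoRow`).
* [IkenmeyerPanova2017] C. Ikenmeyer, G. Panova, Adv. Math. 319 (2017), §1.1 (the semigroup property;
  tree `kroneckerCoeff_pos_of_getD_add`).
* [DorflerIkenmeyerPanova2020] J. Dörfler, C. Ikenmeyer, G. Panova, SIAM J. Appl. Algebra Geom. 4
  (2020) = arXiv:1901.04576, Cor. 4.8 and its proof (arXiv p. 12).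

## Mathlib and tree

Mathlib: `Nat.strong_induction_on`, `interval_cases`, `decide +kernel`, `omega`.
Tree: `kroneckerCoeff_rectangle_rectangle_twoRow`, `getD_sortedParts_twoRow`, `card_parts_twoRow_le`
(`TwoRowRectangleKronecker`, t05 g3); `kroneckerCoeff_pos_of_getD_add` (`KroneckerPointSets`);
`Nat.Partition.sortedParts_rectangle`, `Nat.Partition.length_sortedParts`; `boxPartitionCount_symm`,
`boxPartitionCount_succ_succ`, `boxPartitionCount_one` (`DIP20MonomialCounts`, t07);
`boxPartitionCount_zero` (`DIP20MultiplicityObstructions`); `boxPartitionCount_compl`,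
`DIP20_cor_4_8_of_strict_unimodality` (`GaussianCoefficientUnimodality`, t05 g3);
`PakPanova2013_thm_1`, `StrictGaussianChain`, `PakPanova2013_thm_1_of_lt_below`,
`strictGaussianChain_of_lt_below` (`PP13StrictUnimodality`, x2);
`GaussTable.boxPartitionCount_lt_of_strictBetween`, `GaussTable.boxPartitionCount_eq_of_getD_eq`
(`GaussianCoefficientTable`, t05 g4).
-/

noncomputable section

open scoped BigOperators
open Literature.NumberTheory.DiophantineGeometry

namespace Literature.Computability.AlgebraicComplexity

/-! ### §1. Rows of the shapes `(mˡ)` and `(D-k, k)` -/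

/-- Rows of the rectangle `(mˡ)` (`ℓ` parts equal to `m`): `m` on the first `ℓ` rows, `0` beyond
(also `getD_sortedParts_rectangle` of `OccurrenceObstructionsIPHookPositivity.lean`, not imported here).
[folklore] -/
private theorem getD_rectangle (ℓ m i : ℕ) :
    (Nat.Partition.rectangle ℓ m).sortedParts.getD i 0 = if i < ℓ then m else 0 := by
  rcases Nat.eq_zero_or_pos m with rfl | hm
  · have h0 : (Nat.Partition.rectangle ℓ 0).sortedParts = [] := by
      rw [← List.length_eq_zero_iff, Nat.Partition.length_sortedParts]
      simp [Nat.Partition.rectangle, Nat.Partition.ofSums]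
    rw [h0, List.getD_nil]
    split_ifs <;> rfl
  · rw [Nat.Partition.sortedParts_rectangle _ _ hm.ne']
    split_ifs with h
    · exact List.getD_replicate _ h
    · exact List.getD_eq_default _ _ (by rw [List.length_replicate]; omega)

/-- Row `0` of `τ_k = (D-k, k)` (`2k ≤ D`) is `D - k`. [cite: PakPanova2013, Lemma 3 (`τ_k = (n-k,k)`)] -/
private theorem getD_twoRow_zero {D k : ℕ} (hkD : 2 * k ≤ D) :
    (Nat.Partition.twoRow D k (by omega)).sortedParts.getD 0 0 = D - k := by
  have h := getD_sortedParts_twoRow hkD 0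
  simpa using h

/-- Row `1` of `τ_k = (D-k, k)` (`2k ≤ D`) is `k`. [cite: PakPanova2013, Lemma 3 (`τ_k = (n-k,k)`)] -/
private theorem getD_twoRow_one {D k : ℕ} (hkD : 2 * k ≤ D) :
    (Nat.Partition.twoRow D k (by omega)).sortedParts.getD 1 0 = k := by
  have h := getD_sortedParts_twoRow hkD 1
  simpa using h

/-- `τ_k = (D-k, k)` has no rows beyond the second. [cite: PakPanova2013, Lemma 3 (`τ_k = (n-k,k)`)] -/
private theorem getD_twoRow_add_two {D k : ℕ} (hkD : 2 * k ≤ D) (i : ℕ) :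
    (Nat.Partition.twoRow D k (by omega)).sortedParts.getD (i + 2) 0 = 0 :=
  List.getD_eq_default _ _
    (by rw [Nat.Partition.length_sortedParts]; exact (card_parts_twoRow_le hkD).trans (by omega))

/-! ### §2. Lemma 3 read as positivity; Thm. 4 (semigroup property) for these shapes -/

/-- **Lemma 3, read as positivity**: for `1 ≤ k`, `2k ≤ ℓm`,
`g((mˡ),(mˡ),(ℓm-k,k)) > 0 ⟺ p_{k-1}(ℓ,m) < p_k(ℓ,m)` — from the tree's signed identity
`g = p_k - p_{k-1}` (`kroneckerCoeff_rectangle_rectangle_twoRow`). [cite: PakPanova2013, Lemma 3] -/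
theorem kroneckerCoeff_rectangle_twoRow_pos_iff {ℓ m k : ℕ} (hk : 1 ≤ k) (hkD : 2 * k ≤ ℓ * m) :
    0 < kroneckerCoeff ℂ (Nat.Partition.rectangle ℓ m) (Nat.Partition.rectangle ℓ m)
        (Nat.Partition.twoRow (ℓ * m) k (by omega)) ↔
      boxPartitionCount (k - 1) ℓ m < boxPartitionCount k ℓ m := by
  have h := kroneckerCoeff_rectangle_rectangle_twoRow ℓ m k hkD
  rw [if_neg (by omega)] at h
  constructor <;> intro h' <;> omega

/-- **Lemma 3 at `k = 0`**: `g((mˡ),(mˡ),(ℓm)) = p_0(ℓ,m) = 1 > 0` (the case `r = 0` / `s = 0` of the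
proof of Lemma 2: "for all `r, s ≥ 0, ≠ 1`"). [cite: PakPanova2013, Lemma 3 (with `p_{-1} = 0`)] -/
theorem kroneckerCoeff_rectangle_twoRow_zero_pos (ℓ m : ℕ) :
    0 < kroneckerCoeff ℂ (Nat.Partition.rectangle ℓ m) (Nat.Partition.rectangle ℓ m)
        (Nat.Partition.twoRow (ℓ * m) 0 (Nat.zero_le _)) := by
  have h := kroneckerCoeff_rectangle_rectangle_twoRow ℓ m 0 (Nat.zero_le _)
  rw [if_pos rfl, boxPartitionCount_zero] at h
  omega

/-- **Thm. 4 (semigroup property) applied as in the proof of Lemma 2**: rows add as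
`(m₁ˡ) + (m₂ˡ) = ((m₁+m₂)ˡ)` and `(ℓm₁ - r, r) + (ℓm₂ - s, s) = (ℓ(m₁+m₂) - (r+s), r+s)`, so
`g(m₁ˡ,m₁ˡ,τ_r) > 0` and `g(m₂ˡ,m₂ˡ,τ_s) > 0` give `g((m₁+m₂)ˡ,(m₁+m₂)ˡ,τ_{r+s}) > 0` (by the tree's
`kroneckerCoeff_pos_of_getD_add`). [cite: PakPanova2013, Thm. 4 and proof of Lemma 2 (p. 3)] -/
theorem kroneckerCoeff_rectangle_twoRow_pos_add {ℓ m₁ m₂ r s : ℕ} (hr : 2 * r ≤ ℓ * m₁)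
    (hs : 2 * s ≤ ℓ * m₂)
    (h₁ : 0 < kroneckerCoeff ℂ (Nat.Partition.rectangle ℓ m₁) (Nat.Partition.rectangle ℓ m₁)
        (Nat.Partition.twoRow (ℓ * m₁) r (by omega)))
    (h₂ : 0 < kroneckerCoeff ℂ (Nat.Partition.rectangle ℓ m₂) (Nat.Partition.rectangle ℓ m₂)
        (Nat.Partition.twoRow (ℓ * m₂) s (by omega))) :
    0 < kroneckerCoeff ℂ (Nat.Partition.rectangle ℓ (m₁ + m₂)) (Nat.Partition.rectangle ℓ (m₁ + m₂))
        (Nat.Partition.twoRow (ℓ * (m₁ + m₂)) (r + s) (by nlinarith)) := by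
  have hc : ℓ * (m₁ + m₂) = ℓ * m₁ + ℓ * m₂ := Nat.mul_add ℓ m₁ m₂
  have hrs : 2 * (r + s) ≤ ℓ * (m₁ + m₂) := by omega
  have eR : ∀ i, (Nat.Partition.rectangle ℓ (m₁ + m₂)).sortedParts.getD i 0 =
      (Nat.Partition.rectangle ℓ m₁).sortedParts.getD i 0 +
        (Nat.Partition.rectangle ℓ m₂).sortedParts.getD i 0 := by
    intro i
    rw [getD_rectangle, getD_rectangle, getD_rectangle]
    split_ifs <;> rfl
  refine kroneckerCoeff_pos_of_getD_add ℂ hc eR eR (fun i => ?_) h₁ h₂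
  match i with
  | 0 => rw [getD_twoRow_zero hrs, getD_twoRow_zero hr, getD_twoRow_zero hs]; omega
  | 1 => rw [getD_twoRow_one hrs, getD_twoRow_one hr, getD_twoRow_one hs]
  | i + 2 => rw [getD_twoRow_add_two hrs, getD_twoRow_add_two hr, getD_twoRow_add_two hs]

/-! ### §3. The Additivity Lemma (Lemma 2)

`(∘)` for the pair `(ℓ, m)` is used in its working form "`p_{k-1}(ℓ,m) < p_k(ℓ,m)` for all
`2 ≤ k ≤ ℓm/2`" (the increasing chain `p_1 < p_2 < … < p_{⌊ℓm/2⌋}`); the middle equality and the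
decreasing chain of `(∘)` are automatic by `p_k = p_{ℓm-k}` (§6). -/

/-- The `k = r + s` bookkeeping of the proof of Lemma 2 ("For `k ≤ 3` we can choose `(r,s) = (0,k)` or
`(k,0)` … For `3 < k ≤ ⌊n/2⌋ - 1` … there are values `r, s ≥ 2`, `r ≤ ⌊ℓm₁/2⌋` and `s ≤ ⌊ℓm₂/2⌋`, such
that `k = r+s`. Finally, when `k = ⌊n/2⌋`, by the parity conditions …"), at the level of the sizes
`N₁ = ℓm₁`, `N₂ = ℓm₂`. [cite: PakPanova2013, proof of Lemma 2 (p. 3)] -/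
private theorem exists_split {N₁ N₂ k : ℕ} (h2 : 2 ≤ k) (hk : 2 * k ≤ N₁ + N₂)
    (hpar : Even N₁ ∨ Even N₂) (h4 : 4 ≤ N₁) (h4' : 4 ≤ N₂) (h6 : 6 ≤ N₁ ∨ 6 ≤ N₂) :
    ∃ r s, r + s = k ∧ (r = 0 ∨ 2 ≤ r) ∧ 2 * r ≤ N₁ ∧ (s = 0 ∨ 2 ≤ s) ∧ 2 * s ≤ N₂ := by
  have hpar' : ∃ t, N₁ = 2 * t ∨ N₂ = 2 * t := by
    rcases hpar with ⟨t, ht⟩ | ⟨t, ht⟩ <;> exact ⟨t, by omega⟩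
  obtain ⟨t, ht⟩ := hpar'
  by_cases hA : 2 * k ≤ N₁
  · exact ⟨k, 0, by omega, Or.inr h2, hA, Or.inl rfl, by omega⟩
  by_cases hB : 2 * k ≤ N₂
  · exact ⟨0, k, by omega, Or.inl rfl, by omega, Or.inr h2, hB⟩
  by_cases hs : N₂ / 2 + 2 ≤ k
  · refine ⟨k - N₂ / 2, N₂ / 2, by omega, Or.inr (by omega), ?_, Or.inr (by omega), by omega⟩
    rcases ht with ht | ht <;> omega
  · exact ⟨2, k - 2, by omega, Or.inr le_rfl, by omega, Or.inr (by omega), by omega⟩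

/-- **The Additivity Lemma at the level of the products** `N₁ = ℓm₁`, `N₂ = ℓm₂`: if
`p_{k-1} < p_k` below the middle for `(ℓ,m₁)` and for `(ℓ,m₂)`, one of `ℓm₁, ℓm₂` is even, both are
`≥ 4` and one is `≥ 6`, then `p_{k-1} < p_k` below the middle for `(ℓ, m₁+m₂)`. Proof as printed:
Lemma 3 turns the hypotheses into `g(mᵢˡ,mᵢˡ,τ) > 0` for all two-row `τ` except `τ_1`, the semigroup
property adds them, and every `2 ≤ k ≤ ℓ(m₁+m₂)/2` is `r + s` with admissible `r, s`
(`exists_split`). [cite: PakPanova2013, Lemma 2 (proof, p. 3)] -/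
theorem strictGauss_add {ℓ m₁ m₂ : ℕ}
    (h₁ : ∀ k, 2 ≤ k → 2 * k ≤ ℓ * m₁ → boxPartitionCount (k - 1) ℓ m₁ < boxPartitionCount k ℓ m₁)
    (h₂ : ∀ k, 2 ≤ k → 2 * k ≤ ℓ * m₂ → boxPartitionCount (k - 1) ℓ m₂ < boxPartitionCount k ℓ m₂)
    (hpar : Even (ℓ * m₁) ∨ Even (ℓ * m₂)) (h4 : 4 ≤ ℓ * m₁) (h4' : 4 ≤ ℓ * m₂)
    (h6 : 6 ≤ ℓ * m₁ ∨ 6 ≤ ℓ * m₂) :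
    ∀ k, 2 ≤ k → 2 * k ≤ ℓ * (m₁ + m₂) →
      boxPartitionCount (k - 1) ℓ (m₁ + m₂) < boxPartitionCount k ℓ (m₁ + m₂) := by
  intro k hk2 hk
  have hc : ℓ * (m₁ + m₂) = ℓ * m₁ + ℓ * m₂ := Nat.mul_add ℓ m₁ m₂
  obtain ⟨r, s, hrs, hr0, hr, hs0, hs⟩ :=
    exists_split (N₁ := ℓ * m₁) (N₂ := ℓ * m₂) hk2 (by omega) hpar h4 h4' h6
  have pr : 0 < kroneckerCoeff ℂ (Nat.Partition.rectangle ℓ m₁) (Nat.Partition.rectangle ℓ m₁)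
      (Nat.Partition.twoRow (ℓ * m₁) r (by omega)) := by
    rcases hr0 with rfl | hr2
    · exact kroneckerCoeff_rectangle_twoRow_zero_pos ℓ m₁
    · exact (kroneckerCoeff_rectangle_twoRow_pos_iff (by omega) hr).mpr (h₁ r hr2 hr)
  have ps : 0 < kroneckerCoeff ℂ (Nat.Partition.rectangle ℓ m₂) (Nat.Partition.rectangle ℓ m₂)
      (Nat.Partition.twoRow (ℓ * m₂) s (by omega)) := by
    rcases hs0 with rfl | hs2
    · exact kroneckerCoeff_rectangle_twoRow_zero_pos ℓ m₂
    · exact (kroneckerCoeff_rectangle_twoRow_pos_iff (by omega) hs).mpr (h₂ s hs2 hs)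
  have h := kroneckerCoeff_rectangle_twoRow_pos_add hr hs pr ps
  subst hrs
  exact (kroneckerCoeff_rectangle_twoRow_pos_iff (by omega) hk).mp h

/-- **Lemma 2 (Additivity Lemma)**, in the working form of `(∘)`: "Suppose inequalities `(∘)` as in the
theorem hold for pairs `(ℓ,m₁)` and `(ℓ,m₂)`. Suppose also that at least one of integers `{ℓ,m₁,m₂}` is
even, and at least one `≥ 3`. Then `(∘)` holds for `(ℓ,m₁+m₂)`" — with the proof's "it is implicit
that `ℓ, m₁, m₂ ≥ 2`" made explicit. [cite: PakPanova2013, Lemma 2] -/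
theorem PakPanova2013_lemma_2 {ℓ m₁ m₂ : ℕ} (hℓ : 2 ≤ ℓ) (hm₁ : 2 ≤ m₁) (hm₂ : 2 ≤ m₂)
    (heven : Even ℓ ∨ Even m₁ ∨ Even m₂) (h3 : 3 ≤ ℓ ∨ 3 ≤ m₁ ∨ 3 ≤ m₂)
    (h₁ : ∀ k, 2 ≤ k → 2 * k ≤ ℓ * m₁ → boxPartitionCount (k - 1) ℓ m₁ < boxPartitionCount k ℓ m₁)
    (h₂ : ∀ k, 2 ≤ k → 2 * k ≤ ℓ * m₂ → boxPartitionCount (k - 1) ℓ m₂ < boxPartitionCount k ℓ m₂) :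
    ∀ k, 2 ≤ k → 2 * k ≤ ℓ * (m₁ + m₂) →
      boxPartitionCount (k - 1) ℓ (m₁ + m₂) < boxPartitionCount k ℓ (m₁ + m₂) := by
  refine strictGauss_add h₁ h₂ ?_ ?_ ?_ ?_
  · rcases heven with h | h | h
    · exact Or.inl (h.mul_right m₁)
    · exact Or.inl (h.mul_left ℓ)
    · exact Or.inr (h.mul_left ℓ)
  · exact le_trans (by norm_num) (Nat.mul_le_mul hℓ hm₁)
  · exact le_trans (by norm_num) (Nat.mul_le_mul hℓ hm₂)
  · rcases h3 with h | h | h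
    · exact Or.inl (le_trans (by norm_num) (Nat.mul_le_mul h hm₁))
    · exact Or.inl (le_trans (by norm_num) (Nat.mul_le_mul hℓ h))
    · exact Or.inr (le_trans (by norm_num) (Nat.mul_le_mul hℓ h))

/-! ### §4. Symmetry `(ℓ, m) ↔ (m, ℓ)` -/

/-- The working form of `(∘)` is symmetric in `(ℓ, m)` (`p_k(ℓ,m) = p_k(m,ℓ)`, transposition of the
box; "The cases `ℓ > m` follow from the symmetry", proof of Thm. 6). [cite: PakPanova2013, Thm. 6 (proof: "The cases ℓ > m follow from the symmetry")] -/
theorem strictGauss_symm {ℓ m : ℕ}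
    (h : ∀ k, 2 ≤ k → 2 * k ≤ ℓ * m → boxPartitionCount (k - 1) ℓ m < boxPartitionCount k ℓ m) :
    ∀ k, 2 ≤ k → 2 * k ≤ m * ℓ → boxPartitionCount (k - 1) m ℓ < boxPartitionCount k m ℓ := by
  intro k hk2 hk
  rw [boxPartitionCount_symm (k - 1) m ℓ, boxPartitionCount_symm k m ℓ]
  exact h k hk2 (by rw [Nat.mul_comm ℓ m]; exact hk)

/-! ### §5. The finite base: "a direct calculation" (proof of Thm. 6), by the kernel -/

/-- From the certified table: if the Boolean check of `GaussianCoefficientTable.lean` passes on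
`[2, ℓm/2]`, the working form of `(∘)` holds for `(ℓ, m)`. [cite: PakPanova2013, Thm. 6 (proof: "A direct calculation gives strict unimodality")] -/
theorem strictGauss_of_strictBetween (ℓ m : ℕ)
    (h : GaussTable.strictBetween (GaussTable.coeffList ℓ m) 2 (ℓ * m / 2) = true) :
    ∀ k, 2 ≤ k → 2 * k ≤ ℓ * m → boxPartitionCount (k - 1) ℓ m < boxPartitionCount k ℓ m :=
  fun k hk2 hk => GaussTable.boxPartitionCount_lt_of_strictBetween h k hk2 (by omega)

/-- Base row `ℓ = 8`, `8 ≤ m ≤ 15`. [cite: PakPanova2013, Thm. 6 (proof: "A direct calculation gives strict unimodality for each ℓ ∈ {8,…,15}, and 8 ≤ m < 16")] -/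
theorem strictGauss_grid_8 : ∀ m, 8 ≤ m → m ≤ 15 →
    ∀ k, 2 ≤ k → 2 * k ≤ 8 * m → boxPartitionCount (k - 1) 8 m < boxPartitionCount k 8 m := by
  intro m h1 h2
  interval_cases m <;> exact strictGauss_of_strictBetween _ _ (by decide +kernel)

/-- Base row `ℓ = 9`, `8 ≤ m ≤ 15`. [cite: PakPanova2013, Thm. 6 (proof: "A direct calculation gives strict unimodality for each ℓ ∈ {8,…,15}, and 8 ≤ m < 16")] -/
theorem strictGauss_grid_9 : ∀ m, 8 ≤ m → m ≤ 15 →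
    ∀ k, 2 ≤ k → 2 * k ≤ 9 * m → boxPartitionCount (k - 1) 9 m < boxPartitionCount k 9 m := by
  intro m h1 h2
  interval_cases m <;> exact strictGauss_of_strictBetween _ _ (by decide +kernel)

/-- Base row `ℓ = 10`, `8 ≤ m ≤ 15`. [cite: PakPanova2013, Thm. 6 (proof: "A direct calculation gives strict unimodality for each ℓ ∈ {8,…,15}, and 8 ≤ m < 16")] -/
theorem strictGauss_grid_10 : ∀ m, 8 ≤ m → m ≤ 15 →
    ∀ k, 2 ≤ k → 2 * k ≤ 10 * m → boxPartitionCount (k - 1) 10 m < boxPartitionCount k 10 m := by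
  intro m h1 h2
  interval_cases m <;> exact strictGauss_of_strictBetween _ _ (by decide +kernel)

/-- Base row `ℓ = 11`, `8 ≤ m ≤ 15`. [cite: PakPanova2013, Thm. 6 (proof: "A direct calculation gives strict unimodality for each ℓ ∈ {8,…,15}, and 8 ≤ m < 16")] -/
theorem strictGauss_grid_11 : ∀ m, 8 ≤ m → m ≤ 15 →
    ∀ k, 2 ≤ k → 2 * k ≤ 11 * m → boxPartitionCount (k - 1) 11 m < boxPartitionCount k 11 m := by
  intro m h1 h2
  interval_cases m <;> exact strictGauss_of_strictBetween _ _ (by decide +kernel)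

/-- Base row `ℓ = 12`, `8 ≤ m ≤ 15`. [cite: PakPanova2013, Thm. 6 (proof: "A direct calculation gives strict unimodality for each ℓ ∈ {8,…,15}, and 8 ≤ m < 16")] -/
theorem strictGauss_grid_12 : ∀ m, 8 ≤ m → m ≤ 15 →
    ∀ k, 2 ≤ k → 2 * k ≤ 12 * m → boxPartitionCount (k - 1) 12 m < boxPartitionCount k 12 m := by
  intro m h1 h2
  interval_cases m <;> exact strictGauss_of_strictBetween _ _ (by decide +kernel)

/-- Base row `ℓ = 13`, `8 ≤ m ≤ 15`. [cite: PakPanova2013, Thm. 6 (proof: "A direct calculation gives strict unimodality for each ℓ ∈ {8,…,15}, and 8 ≤ m < 16")] -/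
theorem strictGauss_grid_13 : ∀ m, 8 ≤ m → m ≤ 15 →
    ∀ k, 2 ≤ k → 2 * k ≤ 13 * m → boxPartitionCount (k - 1) 13 m < boxPartitionCount k 13 m := by
  intro m h1 h2
  interval_cases m <;> exact strictGauss_of_strictBetween _ _ (by decide +kernel)

/-- Base row `ℓ = 14`, `8 ≤ m ≤ 15`. [cite: PakPanova2013, Thm. 6 (proof: "A direct calculation gives strict unimodality for each ℓ ∈ {8,…,15}, and 8 ≤ m < 16")] -/
theorem strictGauss_grid_14 : ∀ m, 8 ≤ m → m ≤ 15 →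
    ∀ k, 2 ≤ k → 2 * k ≤ 14 * m → boxPartitionCount (k - 1) 14 m < boxPartitionCount k 14 m := by
  intro m h1 h2
  interval_cases m <;> exact strictGauss_of_strictBetween _ _ (by decide +kernel)

/-- Base row `ℓ = 15`, `8 ≤ m ≤ 15`. [cite: PakPanova2013, Thm. 6 (proof: "A direct calculation gives strict unimodality for each ℓ ∈ {8,…,15}, and 8 ≤ m < 16")] -/
theorem strictGauss_grid_15 : ∀ m, 8 ≤ m → m ≤ 15 →
    ∀ k, 2 ≤ k → 2 * k ≤ 15 * m → boxPartitionCount (k - 1) 15 m < boxPartitionCount k 15 m := by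
  intro m h1 h2
  interval_cases m <;> exact strictGauss_of_strictBetween _ _ (by decide +kernel)

/-- **The base grid** `ℓ, m ∈ {8, …, 15}`: "A direct calculation gives strict unimodality for each
`ℓ ∈ {8,…,15}`, and `8 ≤ m < 16`" — 64 boxes checked by the kernel through the certified `q`-Pascal
table. [cite: PakPanova2013, Thm. 6 (proof)] -/
theorem strictGauss_grid : ∀ ℓ m, 8 ≤ ℓ → ℓ ≤ 15 → 8 ≤ m → m ≤ 15 →
    ∀ k, 2 ≤ k → 2 * k ≤ ℓ * m → boxPartitionCount (k - 1) ℓ m < boxPartitionCount k ℓ m := by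
  intro ℓ m h1 h2 h3 h4
  interval_cases ℓ
  exacts [strictGauss_grid_8 m h3 h4, strictGauss_grid_9 m h3 h4, strictGauss_grid_10 m h3 h4,
    strictGauss_grid_11 m h3 h4, strictGauss_grid_12 m h3 h4, strictGauss_grid_13 m h3 h4,
    strictGauss_grid_14 m h3 h4, strictGauss_grid_15 m h3 h4]

/-! ### §6. Thm. 1 -/

/-- The strip `ℓ ∈ {8,…,15}`, all `m ≥ 8`: "we have that `m = 8a + b` for `a ≥ 1` and `8 ≤ b < 16`.
Applying the additivity lemma successively with `ℓ`, `m₁ = 8k+b`, `m₂ = 8` …". [cite: PakPanova2013, Thm. 6 (proof)] -/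
theorem strictGauss_strip {ℓ : ℕ} (h1 : 8 ≤ ℓ) (h2 : ℓ ≤ 15) : ∀ m, 8 ≤ m →
    ∀ k, 2 ≤ k → 2 * k ≤ ℓ * m → boxPartitionCount (k - 1) ℓ m < boxPartitionCount k ℓ m := by
  intro m
  induction m using Nat.strong_induction_on with
  | _ m ih =>
    intro hm
    by_cases hm' : m ≤ 15
    · exact strictGauss_grid ℓ m h1 h2 hm hm'
    · have hA := ih (m - 8) (by omega) (by omega)
      have hB := strictGauss_grid ℓ 8 h1 h2 le_rfl (by omega)
      have hm8 : 8 ≤ m - 8 := by omega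
      have h := strictGauss_add hA hB (Or.inr ⟨ℓ * 4, by ring⟩)
        (le_trans (by norm_num) (Nat.mul_le_mul h1 hm8)) (le_trans (by norm_num) (Nat.mul_le_mul h1 le_rfl))
        (Or.inr (le_trans (by norm_num) (Nat.mul_le_mul h1 (le_refl 8))))
      rwa [show m - 8 + 8 = m by omega] at h

/-- **Thm. 1, working form**: for all `ℓ, m ≥ 8` and `2 ≤ k ≤ ℓm/2`, `p_{k-1}(ℓ,m) < p_k(ℓ,m)` —
the increasing chain `p_1 < p_2 < … < p_{⌊ℓm/2⌋}` of `(∘)`. Proof as printed (Thm. 6): the base grid,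
then the additivity lemma with `m₂ = 8` in the direction of `m`, symmetry, and the same in the direction
of `ℓ`. [cite: PakPanova2013, Thm. 1] -/
theorem PakPanova2013_thm_1_strict {ℓ m : ℕ} (hℓ : 8 ≤ ℓ) (hm : 8 ≤ m) :
    ∀ k, 2 ≤ k → 2 * k ≤ ℓ * m → boxPartitionCount (k - 1) ℓ m < boxPartitionCount k ℓ m := by
  induction m using Nat.strong_induction_on with
  | _ m ih =>
    by_cases hm' : m ≤ 15
    · exact strictGauss_symm (strictGauss_strip hm hm' ℓ hℓ)
    · have hA := ih (m - 8) (by omega) (by omega)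
      have hB : ∀ k, 2 ≤ k → 2 * k ≤ ℓ * 8 →
          boxPartitionCount (k - 1) ℓ 8 < boxPartitionCount k ℓ 8 :=
        strictGauss_symm (strictGauss_strip (le_refl 8) (by norm_num) ℓ hℓ)
      have hm8 : 8 ≤ m - 8 := by omega
      have h := strictGauss_add hA hB (Or.inr ⟨ℓ * 4, by ring⟩)
        (le_trans (by norm_num) (Nat.mul_le_mul hℓ hm8)) (le_trans (by norm_num) (Nat.mul_le_mul hℓ le_rfl))
        (Or.inr (le_trans (by norm_num) (Nat.mul_le_mul hℓ (le_refl 8))))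
      rwa [show m - 8 + 8 = m by omega] at h

/-- **`PakPanova2013_thm_1` DISCHARGED — Thm. 1 (Pak–Panova 2013) AS PRINTED**: "For all
`ℓ, m ≥ 8`, we have the following strict inequalities:
`(∘) p_1(ℓ,m) < … < p_{⌊ℓm/2⌋}(ℓ,m) = p_{⌈ℓm/2⌉}(ℓ,m) > … > p_{ℓm-1}(ℓ,m)`" — the named fact of the
statement file `PP13StrictUnimodality.lean` (val-lit x2: `StrictGaussianChain ℓ m` for all `ℓ, m ≥ 8`),
from the working form `PakPanova2013_thm_1_strict` by the statement file's reduction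
`PakPanova2013_thm_1_of_lt_below` (middle equality and decreasing chain by Sylvester's palindromicity).
[cite: PakPanova2013, Thm. 1] -/
theorem PakPanova2013_thm_1_holds : PakPanova2013_thm_1 :=
  PakPanova2013_thm_1_of_lt_below fun ℓ m hℓ hm k hk hk' => by
    have h := PakPanova2013_thm_1_strict hℓ hm (k + 1) (by omega) (by omega)
    rwa [Nat.add_sub_cancel] at h

/-- The chain `(∘)` for every pair `ℓ, m ≥ 8` (Thm. 1, unconditional). [cite: PakPanova2013, Thm. 1] -/
theorem strictGaussianChain_of_eight_le {ℓ m : ℕ} (hℓ : 8 ≤ ℓ) (hm : 8 ≤ m) :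
    StrictGaussianChain ℓ m :=
  PakPanova2013_thm_1_holds ℓ m hℓ hm

/-- The working form of `(∘)` gives the printed chain, for any pair (the statement file's
`strictGaussianChain_of_lt_below`, re-indexed). [cite: PakPanova2013, Thm. 1 eq. (∘)] -/
theorem strictGaussianChain_of_strictGauss {ℓ m : ℕ}
    (h : ∀ k, 2 ≤ k → 2 * k ≤ ℓ * m → boxPartitionCount (k - 1) ℓ m < boxPartitionCount k ℓ m) :
    StrictGaussianChain ℓ m :=
  strictGaussianChain_of_lt_below fun k hk hk' => by
    have h' := h (k + 1) (by omega) (by omega)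
    rwa [Nat.add_sub_cancel] at h'

/-! ### §7. Thm. 6: the small cases `ℓ ∈ {5, 6, 7}`, the exceptional pairs, and `ℓ = 2` -/

/-- `ℓ = 5`: `(∘)` for `(5, m)`, all `m ≥ 5` except `m ∈ {6, 10, 14}` (base `5 ≤ m ≤ 22` by the table,
then the additivity lemma with `m₂ = 8` — see PRINT NOTE 1 in the module docstring: the printed step
`m₂ = 10` would invoke the exceptional pair `(5,10)`). [cite: PakPanova2013, Thm. 6] -/
theorem strictGauss_five : ∀ m, 5 ≤ m → m ≠ 6 → m ≠ 10 → m ≠ 14 →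
    ∀ k, 2 ≤ k → 2 * k ≤ 5 * m → boxPartitionCount (k - 1) 5 m < boxPartitionCount k 5 m := by
  intro m
  induction m using Nat.strong_induction_on with
  | _ m ih =>
    intro hm h6 h10 h14
    by_cases hm' : m ≤ 22
    · interval_cases m
      all_goals first
        | exact absurd rfl h6 | exact absurd rfl h10 | exact absurd rfl h14
        | exact strictGauss_of_strictBetween _ _ (by decide +kernel)
    · have hA := ih (m - 8) (by omega) (by omega) (by omega) (by omega) (by omega)
      have hB : ∀ k, 2 ≤ k → 2 * k ≤ 5 * 8 →
          boxPartitionCount (k - 1) 5 8 < boxPartitionCount k 5 8 :=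
        strictGauss_of_strictBetween _ _ (by decide +kernel)
      have h := strictGauss_add hA hB (Or.inr ⟨20, by norm_num⟩) (by omega) (by norm_num)
        (Or.inr (by norm_num))
      rwa [show m - 8 + 8 = m by omega] at h

/-- `ℓ = 6`: `(∘)` for `(6, m)`, all `m ≥ 8` except `m ∈ {9, 11, 13}` (the pairs `(6,6)`, `(6,7)` are
exceptional too; base `8 ≤ m ≤ 21` by the table, then the additivity lemma with `m₂ = 8`).
[cite: PakPanova2013, Thm. 6] -/
theorem strictGauss_six : ∀ m, 8 ≤ m → m ≠ 9 → m ≠ 11 → m ≠ 13 →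
    ∀ k, 2 ≤ k → 2 * k ≤ 6 * m → boxPartitionCount (k - 1) 6 m < boxPartitionCount k 6 m := by
  intro m
  induction m using Nat.strong_induction_on with
  | _ m ih =>
    intro hm h9 h11 h13
    by_cases hm' : m ≤ 21
    · interval_cases m
      all_goals first
        | exact absurd rfl h9 | exact absurd rfl h11 | exact absurd rfl h13
        | exact strictGauss_of_strictBetween _ _ (by decide +kernel)
    · have hA := ih (m - 8) (by omega) (by omega) (by omega) (by omega) (by omega)
      have hB : ∀ k, 2 ≤ k → 2 * k ≤ 6 * 8 →
          boxPartitionCount (k - 1) 6 8 < boxPartitionCount k 6 8 :=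
        strictGauss_of_strictBetween _ _ (by decide +kernel)
      have h := strictGauss_add hA hB (Or.inr ⟨24, by norm_num⟩) (by omega) (by norm_num)
        (Or.inr (by norm_num))
      rwa [show m - 8 + 8 = m by omega] at h

/-- `ℓ = 7`: `(∘)` for `(7, m)`, all `m ≥ 7` except `m = 10` (base `7 ≤ m ≤ 18` by the table, then the
additivity lemma with `m₂ = 8` — the printed step `m₂ = 10` would invoke the exceptional pair
`(7,10)`). [cite: PakPanova2013, Thm. 6] -/
theorem strictGauss_seven : ∀ m, 7 ≤ m → m ≠ 10 →
    ∀ k, 2 ≤ k → 2 * k ≤ 7 * m → boxPartitionCount (k - 1) 7 m < boxPartitionCount k 7 m := by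
  intro m
  induction m using Nat.strong_induction_on with
  | _ m ih =>
    intro hm h10
    by_cases hm' : m ≤ 18
    · interval_cases m
      all_goals first
        | exact absurd rfl h10
        | exact strictGauss_of_strictBetween _ _ (by decide +kernel)
    · have hA := ih (m - 8) (by omega) (by omega) (by omega)
      have hB : ∀ k, 2 ≤ k → 2 * k ≤ 7 * 8 →
          boxPartitionCount (k - 1) 7 8 < boxPartitionCount k 7 8 :=
        strictGauss_of_strictBetween _ _ (by decide +kernel)
      have h := strictGauss_add hA hB (Or.inr ⟨28, by norm_num⟩) (by omega) (by norm_num)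
        (Or.inr (by norm_num))
      rwa [show m - 8 + 8 = m by omega] at h

/-- **Thm. 6, the positive part for `ℓ ≥ 5`**: "Strict unimodality `(∘)` … holds for pairs `(ℓ, m)`,
`ℓ ≤ m`, if … `ℓ, m ≥ 5` with the exception of the following values:
`{(5,6), (5,10), (5,14), (6,6), (6,7), (6,9), (6,11), (6,13), (7,10)}`" (working form of `(∘)`; for
`ℓ ≥ 8` this is Thm. 1). [cite: PakPanova2013, Thm. 6] -/
theorem PakPanova2013_thm_6_strict {ℓ m : ℕ} (hℓ : 5 ≤ ℓ) (hℓm : ℓ ≤ m)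
    (hE : (ℓ, m) ≠ (5, 6) ∧ (ℓ, m) ≠ (5, 10) ∧ (ℓ, m) ≠ (5, 14) ∧ (ℓ, m) ≠ (6, 6) ∧ (ℓ, m) ≠ (6, 7) ∧
      (ℓ, m) ≠ (6, 9) ∧ (ℓ, m) ≠ (6, 11) ∧ (ℓ, m) ≠ (6, 13) ∧ (ℓ, m) ≠ (7, 10)) :
    ∀ k, 2 ≤ k → 2 * k ≤ ℓ * m → boxPartitionCount (k - 1) ℓ m < boxPartitionCount k ℓ m := by
  obtain ⟨e1, e2, e3, e4, e5, e6, e7, e8, e9⟩ := hE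
  have hne : ∀ {a b : ℕ}, (ℓ, m) ≠ (a, b) → ℓ = a → m ≠ b := fun h ha hb => h (by rw [ha, hb])
  by_cases h8 : 8 ≤ ℓ
  · exact PakPanova2013_thm_1_strict h8 (le_trans h8 hℓm)
  · interval_cases ℓ
    · exact strictGauss_five m hℓm (hne e1 rfl) (hne e2 rfl) (hne e3 rfl)
    · exact strictGauss_six m (by have := hne e4 rfl; have := hne e5 rfl; omega) (hne e6 rfl)
        (hne e7 rfl) (hne e8 rfl)
    · exact strictGauss_seven m hℓm (hne e9 rfl)

/-- **Thm. 6, the exceptional pairs**: for eight of the nine listed pairs "the middle three coefficients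
of the expansion of `binom(ℓ+m, m)_q` are equal" — `p_{M-1} = p_M = p_{M+1}`, `M = ℓm/2` — by the
kernel through the certified table. PRINT NOTE: for the listed pair `(6,6)` the middle three
coefficients of `binom(12,6)_q` are `55, 58, 55` (NOT equal); `(∘)` fails there one step earlier,
`p_16(6,6) = p_17(6,6) = 55 < 58 = p_18(6,6)`, which is what is recorded for it.
[cite: PakPanova2013, Thm. 6 (proof: "with the exception of the listed cases, where the middle three coefficients … are equal")] -/
theorem PakPanova2013_thm_6_exceptions :
    (boxPartitionCount 14 5 6 = boxPartitionCount 15 5 6 ∧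
      boxPartitionCount 15 5 6 = boxPartitionCount 16 5 6) ∧
    (boxPartitionCount 24 5 10 = boxPartitionCount 25 5 10 ∧
      boxPartitionCount 25 5 10 = boxPartitionCount 26 5 10) ∧
    (boxPartitionCount 34 5 14 = boxPartitionCount 35 5 14 ∧
      boxPartitionCount 35 5 14 = boxPartitionCount 36 5 14) ∧
    (boxPartitionCount 16 6 6 = boxPartitionCount 17 6 6 ∧
      boxPartitionCount 17 6 6 < boxPartitionCount 18 6 6) ∧
    (boxPartitionCount 20 6 7 = boxPartitionCount 21 6 7 ∧
      boxPartitionCount 21 6 7 = boxPartitionCount 22 6 7) ∧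
    (boxPartitionCount 26 6 9 = boxPartitionCount 27 6 9 ∧
      boxPartitionCount 27 6 9 = boxPartitionCount 28 6 9) ∧
    (boxPartitionCount 32 6 11 = boxPartitionCount 33 6 11 ∧
      boxPartitionCount 33 6 11 = boxPartitionCount 34 6 11) ∧
    (boxPartitionCount 38 6 13 = boxPartitionCount 39 6 13 ∧
      boxPartitionCount 39 6 13 = boxPartitionCount 40 6 13) ∧
    (boxPartitionCount 34 7 10 = boxPartitionCount 35 7 10 ∧
      boxPartitionCount 35 7 10 = boxPartitionCount 36 7 10) := by
  refine ⟨⟨?_, ?_⟩, ⟨?_, ?_⟩, ⟨?_, ?_⟩, ⟨?_, ?lt⟩, ⟨?_, ?_⟩, ⟨?_, ?_⟩, ⟨?_, ?_⟩, ⟨?_, ?_⟩, ⟨?_, ?_⟩⟩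
  case lt =>
    exact GaussTable.boxPartitionCount_lt_of_strictBetween (d := 6) (n := 6) (a := 18) (b := 18)
      (by decide +kernel) 18 le_rfl le_rfl
  all_goals exact GaussTable.boxPartitionCount_eq_of_getD_eq (by decide +kernel)

/-- An equality `p_{M-1} = p_M` with `2 ≤ M ≤ ℓm/2` violates the working form of `(∘)`. [cite: PakPanova2013, Thm. 6] -/
private theorem not_strict_of_eq {ℓ m M : ℕ} (h2 : 2 ≤ M) (hM : 2 * M ≤ ℓ * m)
    (he : boxPartitionCount (M - 1) ℓ m = boxPartitionCount M ℓ m) :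
    ¬ ∀ k, 2 ≤ k → 2 * k ≤ ℓ * m → boxPartitionCount (k - 1) ℓ m < boxPartitionCount k ℓ m := by
  intro h
  have h' := h M h2 hM
  rw [he] at h'
  exact lt_irrefl _ h'

/-- **Thm. 6, "only if" at the exceptional pairs**: at each of the nine listed pairs
`(5,6), (5,10), (5,14), (6,6), (6,7), (6,9), (6,11), (6,13), (7,10)` the working form of `(∘)` fails
(the step `p_{M-1} < p_M`, `M = ℓm/2`, is an equality — for `(6,6)` the step `p_16 < p_17`).
[cite: PakPanova2013, Thm. 6] -/
theorem PakPanova2013_thm_6_exceptions_not_strict :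
    (¬ ∀ k, 2 ≤ k → 2 * k ≤ 5 * 6 → boxPartitionCount (k - 1) 5 6 < boxPartitionCount k 5 6) ∧
    (¬ ∀ k, 2 ≤ k → 2 * k ≤ 5 * 10 → boxPartitionCount (k - 1) 5 10 < boxPartitionCount k 5 10) ∧
    (¬ ∀ k, 2 ≤ k → 2 * k ≤ 5 * 14 → boxPartitionCount (k - 1) 5 14 < boxPartitionCount k 5 14) ∧
    (¬ ∀ k, 2 ≤ k → 2 * k ≤ 6 * 6 → boxPartitionCount (k - 1) 6 6 < boxPartitionCount k 6 6) ∧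
    (¬ ∀ k, 2 ≤ k → 2 * k ≤ 6 * 7 → boxPartitionCount (k - 1) 6 7 < boxPartitionCount k 6 7) ∧
    (¬ ∀ k, 2 ≤ k → 2 * k ≤ 6 * 9 → boxPartitionCount (k - 1) 6 9 < boxPartitionCount k 6 9) ∧
    (¬ ∀ k, 2 ≤ k → 2 * k ≤ 6 * 11 → boxPartitionCount (k - 1) 6 11 < boxPartitionCount k 6 11) ∧
    (¬ ∀ k, 2 ≤ k → 2 * k ≤ 6 * 13 → boxPartitionCount (k - 1) 6 13 < boxPartitionCount k 6 13) ∧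
    (¬ ∀ k, 2 ≤ k → 2 * k ≤ 7 * 10 → boxPartitionCount (k - 1) 7 10 < boxPartitionCount k 7 10) := by
  obtain ⟨⟨a1, -⟩, ⟨a2, -⟩, ⟨a3, -⟩, ⟨a4, -⟩, ⟨a5, -⟩, ⟨a6, -⟩, ⟨a7, -⟩, ⟨a8, -⟩, ⟨a9, -⟩⟩ :=
    PakPanova2013_thm_6_exceptions
  exact ⟨not_strict_of_eq (M := 15) (by norm_num) (by norm_num) a1,
    not_strict_of_eq (M := 25) (by norm_num) (by norm_num) a2,
    not_strict_of_eq (M := 35) (by norm_num) (by norm_num) a3,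
    not_strict_of_eq (M := 17) (by norm_num) (by norm_num) a4,
    not_strict_of_eq (M := 21) (by norm_num) (by norm_num) a5,
    not_strict_of_eq (M := 27) (by norm_num) (by norm_num) a6,
    not_strict_of_eq (M := 33) (by norm_num) (by norm_num) a7,
    not_strict_of_eq (M := 39) (by norm_num) (by norm_num) a8,
    not_strict_of_eq (M := 35) (by norm_num) (by norm_num) a9⟩

/-- `p_2(2, m) = 2` for `m ≥ 2` (the partitions `(2)`, `(1,1)`), from the `q`-Pascal rule.
[cite: PakPanova2013, Thm. 6 (proof: "case ℓ = 2 is straightforward, since p_{2i}(2,m) = p_{2i+1}(2,m)")] -/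
private theorem boxPartitionCount_two_two (n : ℕ) : boxPartitionCount 2 2 (n + 2) = 2 := by
  rw [boxPartitionCount_succ_succ, boxPartitionCount_one, if_pos (by omega), if_pos le_rfl,
    boxPartitionCount_zero]

/-- `p_1(2, m) = 1` for `m ≥ 1`. [cite: PakPanova2013, Thm. 6 (proof, case ℓ = 2)] -/
private theorem boxPartitionCount_one_two (n : ℕ) : boxPartitionCount 1 2 (n + 1) = 1 := by
  rw [boxPartitionCount_succ_succ, boxPartitionCount_one, if_pos (by omega), if_neg (by omega)]

/-- `p_3(2, m) = 2` for `m ≥ 3` (the partitions `(3)`, `(2,1)`). [cite: PakPanova2013, Thm. 6 (proof, case ℓ = 2)] -/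
private theorem boxPartitionCount_three_two (n : ℕ) : boxPartitionCount 3 2 (n + 3) = 2 := by
  rw [boxPartitionCount_succ_succ, boxPartitionCount_one, if_pos (by omega), if_pos (by omega),
    show 3 - (1 + 1) = 1 from rfl, boxPartitionCount_one_two]

/-- **Thm. 6, `ℓ = 2`**: the working form of `(∘)` holds for `(2, 2)` and fails for `(2, m)`, `m ≥ 3`
("case `ℓ = 2` is straightforward, since `p_{2i}(2,m) = p_{2i+1}(2,m)` for all `i < n/4`"; here
`p_2(2,m) = p_3(2,m) = 2`). [cite: PakPanova2013, Thm. 6] -/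
theorem PakPanova2013_thm_6_two :
    (∀ k, 2 ≤ k → 2 * k ≤ 2 * 2 → boxPartitionCount (k - 1) 2 2 < boxPartitionCount k 2 2) ∧
    ∀ m, 3 ≤ m → ¬ ∀ k, 2 ≤ k → 2 * k ≤ 2 * m →
      boxPartitionCount (k - 1) 2 m < boxPartitionCount k 2 m := by
  refine ⟨strictGauss_of_strictBetween _ _ (by decide +kernel), fun m hm h => ?_⟩
  obtain ⟨n, rfl⟩ : ∃ n, m = n + 3 := ⟨m - 3, by omega⟩
  have h3 := h 3 (by norm_num) (by omega)
  rw [show (3 - 1 : ℕ) = 2 from rfl, show n + 3 = (n + 1) + 2 from rfl, boxPartitionCount_two_two,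
    show n + 1 + 2 = n + 3 from rfl, boxPartitionCount_three_two] at h3
  exact lt_irrefl _ h3

/-! ### §8. Consequence for DIP20: hypothesis (H2) of Cor. 4.8 and `DIP20_cor_4_8_holds` -/

/-- **Hypothesis (H2) of `DIP20_cor_4_8_of_strict_unimodality` holds**: strict unimodality of
`p_k(n+1, n-2)` below the middle, for `n ≥ 7`, `k ≥ 1`, except at `(n,k) = (8,26)` and `(9,34)` — for
`n ≥ 10` this is Thm. 1 with `(ℓ, m) = (n+1, n-2)`; `n = 7, 8, 9` are the boxes `8×5`, `9×6` (`k+1 ≤ 26`),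
`10×7` (`k+1 ≤ 34`) by the table, the excluded steps being the equal middle pairs of the exceptional
pairs `(6,9)`, `(7,10)` of Thm. 6. [cite: PakPanova2013, Thm. 1 and Thm. 6] [cite: DorflerIkenmeyerPanova2020, Cor. 4.8 (proof, arXiv p. 12: "strict unimodality … [PP13]")] -/
theorem DIP20_strict_unimodality (n k : ℕ) (hn : 7 ≤ n) (hk : 1 ≤ k)
    (h : 2 * (n + k + 1) ≤ n ^ 2 + n - 2) (h8 : (n, k) ≠ (8, 26)) (h9 : (n, k) ≠ (9, 34)) :
    boxPartitionCount k (n + 1) (n - 2) < boxPartitionCount (k + 1) (n + 1) (n - 2) := by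
  obtain ⟨t, rfl⟩ : ∃ t, n = t + 7 := ⟨n - 7, by omega⟩
  rw [show t + 7 - 2 = t + 5 from rfl]
  have hK : 2 * (k + 1) ≤ (t + 7 + 1) * (t + 5) := by
    have h' : 2 * (t + 7 + k + 1) ≤ (t + 7) ^ 2 + (t + 7) - 2 := h
    ring_nf at h' ⊢
    omega
  have hne : ∀ {a b : ℕ}, (t + 7, k) ≠ (a, b) → t + 7 = a → k ≠ b := fun h ha hb => h (by rw [ha, hb])
  rcases Nat.lt_or_ge t 3 with ht | ht
  · interval_cases t
    · have h' := strictGauss_of_strictBetween 8 5 (by decide +kernel) (k + 1) (by omega) hK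
      rwa [Nat.add_sub_cancel] at h'
    · have hk26 : k ≠ 26 := hne h8 rfl
      have h' := GaussTable.boxPartitionCount_lt_of_strictBetween (d := 9) (n := 6) (a := 2) (b := 26)
        (by decide +kernel) (k + 1) (by omega) (by omega)
      rwa [Nat.add_sub_cancel] at h'
    · have hk34 : k ≠ 34 := hne h9 rfl
      have h' := GaussTable.boxPartitionCount_lt_of_strictBetween (d := 10) (n := 7) (a := 2) (b := 34)
        (by decide +kernel) (k + 1) (by omega) (by omega)
      rwa [Nat.add_sub_cancel] at h'
  · have h' := PakPanova2013_thm_1_strict (ℓ := t + 7 + 1) (m := t + 5) (by omega) (by omega) (k + 1)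
      (by omega) hK
    rwa [Nat.add_sub_cancel] at h'

/-- **`DIP20_cor_4_8` DISCHARGED** (Dörfler–Ikenmeyer–Panova 2020, Cor. 4.8 as typed, with the errata
E3/E4 of the statement file): by `DIP20_cor_4_8_of_strict_unimodality` (t05 g3: Sylvester's theorem
for (H1)) and `DIP20_strict_unimodality` (Pak–Panova 2013 for (H2)). [cite: DorflerIkenmeyerPanova2020, Cor. 4.8 (arXiv p. 12)] [cite: PakPanova2013, Thm. 1] -/
theorem DIP20_cor_4_8_holds : DIP20_cor_4_8 :=
  DIP20_cor_4_8_of_strict_unimodality DIP20_strict_unimodality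

end Literature.Computability.AlgebraicComplexity
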